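import Summits.CriticalPhenomena.PercolationContinuityZ3.Theorems.PercNearOneGluingNoHeavyLowerTailSwitchRelaxFinc28ChecksC
import HarnessLib

/-!
# Finite-relaxation replay of the clean switching certificate `Finc28`: kernel checks at input types (pieces `checkAtY_6_9` … `checkAt_12`)

Support file (prover prim-masterthm-p1 gen 2; `--supports stmt-CriticalPhenomena-4575`).  No named facts, no sorries.  Split from
`…SwitchRelaxFinc28` only to keep each file's kernel time small.
-/

namespace Summit.CriticalPhenomena.PercolationContinuityZ3.Theorems

namespace SwitchRelax

namespace Finc28

/-- Kernel evaluation of the finite relaxation at input type `6`, `Y`-type `9`. [this work] -/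
theorem checkAtY_6_9 : certFinc28.checkAtY 6 9 = true := by decide +kernel

/-- Kernel evaluation of the finite relaxation at input type `6`, `Y`-type `10`. [this work] -/
theorem checkAtY_6_10 : certFinc28.checkAtY 6 10 = true := by decide +kernel

/-- Kernel evaluation of the finite relaxation at input type `6`, `Y`-type `11`. [this work] -/
theorem checkAtY_6_11 : certFinc28.checkAtY 6 11 = true := by decide +kernel

/-- Kernel evaluation of the finite relaxation at input type `6`, `Y`-type `12`. [this work] -/
theorem checkAtY_6_12 : certFinc28.checkAtY 6 12 = true := by decide +kernel

/-- Kernel evaluation of the finite relaxation at input type `6`, `Y`-type `13`. [this work] -/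
theorem checkAtY_6_13 : certFinc28.checkAtY 6 13 = true := by decide +kernel

/-- Kernel evaluation of the finite relaxation at input type `6`, `Y`-type `14`. [this work] -/
theorem checkAtY_6_14 : certFinc28.checkAtY 6 14 = true := by decide +kernel

/-- The check at input type `6` from its fifteen `Y`-type pieces. [this work] -/
theorem checkAt_6 : certFinc28.checkAt 6 = true :=
  Cert.checkAt_of_piecesY certFinc28 6 checkAtY_6_0 checkAtY_6_1 checkAtY_6_2 checkAtY_6_3 checkAtY_6_4 checkAtY_6_5 checkAtY_6_6 checkAtY_6_7 checkAtY_6_8 checkAtY_6_9 checkAtY_6_10 checkAtY_6_11 checkAtY_6_12 checkAtY_6_13 checkAtY_6_14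

/-- Kernel evaluation of the finite relaxation at input type `7`. [this work] -/
theorem checkAt_7 : certFinc28.checkAt 7 = true := by decide +kernel

/-- Kernel evaluation of the finite relaxation at input type `8`. [this work] -/
theorem checkAt_8 : certFinc28.checkAt 8 = true := by decide +kernel

/-- Kernel evaluation of the finite relaxation at input type `9`. [this work] -/
theorem checkAt_9 : certFinc28.checkAt 9 = true := by decide +kernel

/-- Kernel evaluation of the finite relaxation at input type `10`. [this work] -/
theorem checkAt_10 : certFinc28.checkAt 10 = true := by decide +kernel

/-- Kernel evaluation of the finite relaxation at input type `11`. [this work] -/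
theorem checkAt_11 : certFinc28.checkAt 11 = true := by decide +kernel

/-- Kernel evaluation of the finite relaxation at input type `12`. [this work] -/
theorem checkAt_12 : certFinc28.checkAt 12 = true := by decide +kernel

end Finc28

end SwitchRelax

end Summit.CriticalPhenomena.PercolationContinuityZ3.Theorems
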